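import Mathlib
import Summits.Ventures.HodgeRepro.Tier4.Target
import Summits.Ventures.HodgeRepro.Tier4.Line3.Defs
import Summits.Ventures.HodgeRepro.Tier4.Line3.DefsLemmas
import Summits.Ventures.HodgeRepro.Tier4.Line3.Witness.Coercive

/-!
# Tier4/Line3/Witness/ThetaDataWitnessCf — the cf-side R4 witness of LINE L3's `ThetaData` (clauses `weight`,
`invΓ`, `support`, `decay`)
(seat t4-L2-p2, gen 0, on t4-plan-3's word S12460; blind re-derivation cell `pub-hodge-repro`, Tier 4, README §9–§10)

R4 (lead S12285 / S12338): the interfaces a line quantifies over must be WITNESSED.  `ThetaData` (`Tier4/Line3/Defs.lean`,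
the skeleton v0.19's identification data) has four PRINTED fields `ident₀ … ident₃` (the tie to the given lifts, not
witnessable in Lean) and the STRUCTURAL clauses `invΓ`, `weight`, `equiv`, `summable`, `decay`, `support`, `nondeg`.
This module witnesses the coefficient-function side with the shape of the genuine object — the Gaussian of the definite
places on the vectors with a norm-one multiple in the standard lattice (plan-3's spec S12460 (i)):

* `Lstd = 𝒪_{E′}³` (`isLattice_Lstd`; `mem_Lstd_iff`: integral coordinates);
* `cfW j x = if ∃ t ∈ E′^1, t • x ∈ Lstd then gaussDef x else 0`;
* `cfW_weight` (E′^1-invariance: the condition is torus-stable, `gaussDef (t • x) = gaussDef x` because `|σ t| = 1`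
  at every embedding — `σ (c t) = conj (σ t)`, Mathlib's `IsCMField.complexEmbedding_complexConj`);
* `cfW_invΓ` (`Γ`-invariance: `Γ ⊆ Γ(1)` is integral with integral inverses, so `γ Lstd = Lstd`, and `H`-unitary, so
  `gaussDef (γ x) = gaussDef x` at every embedding);
* `cfW_support` (`S = {Lstd}`);
* `cfW_decay` (`‖cfW j x‖ ≤ gaussDef x ≤ exp (−π |H_σ(σx, σx)|) ≤ exp (−c₀ Σ_i ‖σ (x i)‖²)` for every definite `σ`,
  with `c₀ = π · min_σ λ_σ` from the coercivity `Witness/Coercive.lean`; `C = 1`, `e = 0`).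

`summable` (the Gaussian majorant over the lattice) and the Φ-side clauses are separate modules.  Mathlib + the line's
definitions; no printed input.  Nothing here says anything about the status of the Hodge conjecture for CM abelian
varieties, which is NOT proved (HC_CM is NOT proved by anyone in this repository).
-/

set_option autoImplicit false

namespace Summit.Ventures.HodgeRepro.Tier4.Line3

open Matrix NumberField
open scoped ComplexConjugate ComplexOrder
open scoped Classical

noncomputable section


/-- For a definite `M` (positive or negative definite), `|re (v^* M v)| ≥ λ ‖v‖²` for some `λ > 0`. -/
theorem exists_coercive_abs_of_isDefinite {M : Matrix (Fin 3) (Fin 3) ℂ} (hM : IsDefinite M) :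
    ∃ lam : ℝ, 0 < lam ∧ ∀ v : Fin 3 → ℂ, lam * ∑ i, ‖v i‖ ^ 2 ≤ |(star v ⬝ᵥ (M *ᵥ v)).re| := by
  rcases hM with h | h
  · obtain ⟨lam, hl, hb⟩ := exists_coercive_of_posDef h
    exact ⟨lam, hl, fun v => (hb v).trans (le_abs_self _)⟩
  · obtain ⟨lam, hl, hb⟩ := exists_coercive_of_posDef h
    refine ⟨lam, hl, fun v => ?_⟩
    have := hb v
    rw [Matrix.neg_mulVec, dotProduct_neg, Complex.neg_re] at this
    exact this.trans (neg_le_abs _)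

namespace T4Data

variable (X : T4Data)

/-! ## The cf-side R4 witness: the standard lattice and the Gaussian coefficient function -/

/-- The standard lattice `𝒪_{E′}³ ⊆ E′³` (the `𝒪`-span of the standard basis). -/
def Lstd : Submodule (RingOfIntegers X.E) (Fin 3 → X.E) :=
  Submodule.span (RingOfIntegers X.E) (Set.range fun i : Fin 3 => (Pi.single i (1 : X.E) : Fin 3 → X.E))

/-- Membership in `Lstd`: every coordinate is an algebraic integer. -/
theorem mem_Lstd_iff (v : Fin 3 → X.E) : v ∈ X.Lstd ↔ ∀ i, IsIntegral ℤ (v i) := by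
  rw [Lstd, Submodule.mem_span_range_iff_exists_fun]
  constructor
  · rintro ⟨c, rfl⟩ i
    have : (∑ j, c j • (Pi.single j (1 : X.E) : Fin 3 → X.E)) i = (c i : X.E) := by
      simp [Finset.sum_apply, Pi.single_apply, Algebra.smul_def]
    rw [this]
    exact (c i).isIntegral_coe
  · intro h
    refine ⟨fun i => ⟨v i, h i⟩, ?_⟩
    funext i
    simp [Finset.sum_apply, Pi.single_apply, Algebra.smul_def]

/-- `Lstd` is a lattice: finitely generated, spanning `E′³`. -/
theorem isLattice_Lstd : X.IsLattice X.Lstd := by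
  refine ⟨Submodule.fg_span (Set.finite_range _), ?_⟩
  rw [Lstd, Submodule.span_span_of_tower]
  have := (Pi.basisFun X.E (Fin 3)).span_eq
  rwa [show (⇑(Pi.basisFun X.E (Fin 3)) : Fin 3 → Fin 3 → X.E) = fun i => Pi.single i 1 from
    funext fun i => Pi.basisFun_apply X.E (Fin 3) i] at this

/-- The cf-side witness: the Gaussian of the definite places on the lines meeting the standard lattice. -/
def cfW (_j : Fin 4) (x : Fin 3 → X.E) : ℂ :=
  if ∃ t : X.E, X.c t * t = 1 ∧ t • x ∈ X.Lstd then ((X.gaussDef x : ℝ) : ℂ) else 0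

/-- `σ (c t) = conj (σ t)` for every complex embedding `σ` of the CM field `E′`. -/
theorem map_c (σ : X.E →+* ℂ) (t : X.E) : σ (X.c t) = conj (σ t) :=
  NumberField.IsCMField.complexEmbedding_complexConj X.E σ t

/-- A norm-one scalar has `|σ t| = 1` at every embedding: `conj (σ t) * σ t = σ (c t * t) = 1`. -/
theorem conj_mul_self_of_norm_one (σ : X.E →+* ℂ) {t : X.E} (ht : X.c t * t = 1) :
    conj (σ t) * σ t = 1 := by
  rw [← map_c, ← map_mul, ht, map_one]

/-- The Gaussian of the definite places is invariant under the norm-one scalars. -/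
theorem gaussDef_smul {t : X.E} (ht : X.c t * t = 1) (x : Fin 3 → X.E) :
    X.gaussDef (t • x) = X.gaussDef x := by
  unfold gaussDef
  refine finprod_congr fun σ => finprod_congr fun _ => ?_
  congr 3
  have hv : (fun i => σ ((t • x) i)) = σ t • fun i => σ (x i) := by
    funext i
    simp [Pi.smul_apply, smul_eq_mul, map_mul]
  rw [hv, star_smul, Matrix.mulVec_smul, smul_dotProduct, dotProduct_smul, smul_eq_mul, smul_eq_mul,
    ← mul_assoc, Complex.star_def, conj_mul_self_of_norm_one X σ ht, one_mul]

/-- `weight`: the witness is invariant under the norm-one scalars. -/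
theorem cfW_weight (j : Fin 4) (t : X.E) (ht : X.c t * t = 1) (x : Fin 3 → X.E) :
    X.cfW j (t • x) = X.cfW j x := by
  have ht0 : t ≠ 0 := by
    rintro rfl
    simp at ht
  have hiff : (∃ t' : X.E, X.c t' * t' = 1 ∧ t' • (t • x) ∈ X.Lstd) ↔
      ∃ t' : X.E, X.c t' * t' = 1 ∧ t' • x ∈ X.Lstd := by
    constructor
    · rintro ⟨t', ht', hmem⟩
      refine ⟨t' * t, ?_, by rwa [mul_smul]⟩
      rw [map_mul]
      calc X.c t' * X.c t * (t' * t) = (X.c t' * t') * (X.c t * t) := by ring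
        _ = 1 := by rw [ht', ht, one_mul]
    · rintro ⟨t', ht', hmem⟩
      refine ⟨t' * t⁻¹, ?_, ?_⟩
      · have hct : X.c t ≠ 0 := by
          intro h
          rw [h, zero_mul] at ht
          exact zero_ne_one ht
        rw [map_mul, map_inv₀]
        calc X.c t' * (X.c t)⁻¹ * (t' * t⁻¹) = (X.c t' * t') * (X.c t * t)⁻¹ := by
              rw [mul_inv]; ring
          _ = 1 := by rw [ht', ht, inv_one, one_mul]
      · rwa [mul_smul, inv_smul_smul₀ ht0]
  unfold cfW
  rw [gaussDef_smul X ht]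
  by_cases h : ∃ t' : X.E, X.c t' * t' = 1 ∧ t' • x ∈ X.Lstd
  · rw [if_pos (hiff.mpr h), if_pos h]
  · rw [if_neg (fun h' => h (hiff.mp h')), if_neg h]

/-- `support`: the witness is supported, up to the torus, in the single lattice `Lstd`. -/
theorem cfW_support :
    ∃ S : Finset (Submodule (RingOfIntegers X.E) (Fin 3 → X.E)), (∀ L ∈ S, X.IsLattice L) ∧
      ∀ j x, X.cfW j x ≠ 0 → ∃ t : X.E, X.c t * t = 1 ∧ ∃ L ∈ S, t • x ∈ L := by
  refine ⟨{X.Lstd}, ?_, fun j x hx => ?_⟩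
  · intro L hL
    rw [Finset.mem_singleton] at hL
    rw [hL]
    exact X.isLattice_Lstd
  · by_contra hcon
    apply hx
    unfold cfW
    rw [if_neg]
    rintro ⟨t, ht, hmem⟩
    exact hcon ⟨t, ht, X.Lstd, Finset.mem_singleton_self _, hmem⟩


/-! ### `invΓ`: the witness is `Γ`-invariant -/

/-- An integral matrix maps `Lstd` into itself. -/
theorem mulVec_mem_Lstd {g : Matrix (Fin 3) (Fin 3) X.E} (hg : IsIntegralMatrix g) {v : Fin 3 → X.E}
    (hv : v ∈ X.Lstd) : g *ᵥ v ∈ X.Lstd := by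
  rw [mem_Lstd_iff] at hv ⊢
  intro i
  simp only [Matrix.mulVec, dotProduct]
  exact IsIntegral.sum _ fun j _ => (hg i j).mul (hv j)

/-- An element of `Γ` has an inverse in `Γ`, which is integral. -/
theorem exists_inv_mem_Γ {γ : Matrix (Fin 3) (Fin 3) X.E} (hγ : γ ∈ X.Γ) :
    ∃ δ ∈ X.Γ, γ * δ = 1 ∧ δ * γ = 1 := by
  obtain ⟨δ, hδ, hγδ⟩ := X.hΓ.2.2.1 γ hγ
  exact ⟨δ, hδ, hγδ, mul_eq_one_comm.mp hγδ⟩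

/-- Elements of `Γ` are integral and `H`-unitary (`Γ ⊆ Γ(1)`). -/
theorem integral_of_mem_Γ {γ : Matrix (Fin 3) (Fin 3) X.E} (hγ : γ ∈ X.Γ) : IsIntegralMatrix γ :=
  (X.hΓ.2.2.2.1 hγ).2.1

/-- Elements of `Γ` are `H`-unitary. -/
theorem unitary_of_mem_Γ {γ : Matrix (Fin 3) (Fin 3) X.E} (hγ : γ ∈ X.Γ) : IsUnitaryOf X.c X.H γ :=
  (X.hΓ.2.2.2.1 hγ).1

/-- For `γ ∈ Γ`, `γ *ᵥ v ∈ Lstd ↔ v ∈ Lstd`. -/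
theorem mulVec_mem_Lstd_iff {γ : Matrix (Fin 3) (Fin 3) X.E} (hγ : γ ∈ X.Γ) (v : Fin 3 → X.E) :
    γ *ᵥ v ∈ X.Lstd ↔ v ∈ X.Lstd := by
  obtain ⟨δ, hδ, -, hδγ⟩ := X.exists_inv_mem_Γ hγ
  constructor
  · intro h
    have := X.mulVec_mem_Lstd (X.integral_of_mem_Γ hδ) h
    rwa [Matrix.mulVec_mulVec, hδγ, Matrix.one_mulVec] at this
  · exact X.mulVec_mem_Lstd (X.integral_of_mem_Γ hγ)

/-- The image of the `c`-adjoint under a complex embedding is the conjugate transpose. -/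
theorem map_cstar (σ : X.E →+* ℂ) (g : Matrix (Fin 3) (Fin 3) X.E) :
    (cstar X.c g).map σ = (g.map σ)ᴴ := by
  ext i j
  simp [cstar, Matrix.conjTranspose_apply, map_c]

/-- A `H`-unitary matrix is `H_σ`-unitary at every embedding. -/
theorem map_unitary (σ : X.E →+* ℂ) {g : Matrix (Fin 3) (Fin 3) X.E} (hg : IsUnitaryOf X.c X.H g) :
    (g.map σ)ᴴ * X.H.map σ * g.map σ = X.H.map σ := by
  have := congrArg (fun A : Matrix (Fin 3) (Fin 3) X.E => A.map σ) hg
  simpa [Matrix.map_mul, map_cstar] using this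

/-- The hermitian form `star v ⬝ᵥ (H_σ v)` is invariant under `H_σ`-unitary matrices. -/
theorem hermForm_mulVec (Hσ g : Matrix (Fin 3) (Fin 3) ℂ) (hg : gᴴ * Hσ * g = Hσ) (v : Fin 3 → ℂ) :
    star (g *ᵥ v) ⬝ᵥ (Hσ *ᵥ (g *ᵥ v)) = star v ⬝ᵥ (Hσ *ᵥ v) := by
  rw [Matrix.star_mulVec, ← Matrix.dotProduct_mulVec, Matrix.mulVec_mulVec, Matrix.mulVec_mulVec, hg]

/-- The Gaussian of the definite places is `Γ`-invariant. -/
theorem gaussDef_mulVec {γ : Matrix (Fin 3) (Fin 3) X.E} (hγ : γ ∈ X.Γ) (x : Fin 3 → X.E) :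
    X.gaussDef (γ *ᵥ x) = X.gaussDef x := by
  unfold gaussDef
  refine finprod_congr fun σ => finprod_congr fun _ => ?_
  congr 3
  have hv : (fun i => σ ((γ *ᵥ x) i)) = γ.map σ *ᵥ fun i => σ (x i) := by
    funext i
    simp [Matrix.mulVec, dotProduct, map_sum, map_mul]
  rw [hv, hermForm_mulVec _ _ (X.map_unitary σ (X.unitary_of_mem_Γ hγ))]

/-- `invΓ`: the witness is `Γ`-invariant. -/
theorem cfW_invΓ (j : Fin 4) {γ : Matrix (Fin 3) (Fin 3) X.E} (hγ : γ ∈ X.Γ) (x : Fin 3 → X.E) :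
    X.cfW j (γ *ᵥ x) = X.cfW j x := by
  have hiff : (∃ t : X.E, X.c t * t = 1 ∧ t • (γ *ᵥ x) ∈ X.Lstd) ↔
      ∃ t : X.E, X.c t * t = 1 ∧ t • x ∈ X.Lstd := by
    simp only [← Matrix.mulVec_smul, X.mulVec_mem_Lstd_iff hγ]
  unfold cfW
  rw [gaussDef_mulVec X hγ]
  by_cases h : ∃ t : X.E, X.c t * t = 1 ∧ t • x ∈ X.Lstd
  · rw [if_pos (hiff.mpr h), if_pos h]
  · rw [if_neg (fun h' => h (hiff.mp h')), if_neg h]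


/-! ### `decay`: the Gaussian of the definite places is bounded by a Gaussian in the coordinates of every definite
embedding (coercivity of a definite hermitian form, `Coercive.lean`) -/

/-- The per-embedding coercivity constants of the definite places. -/
theorem exists_lam (σ : X.E →+* ℂ) (h1 : σ ≠ X.τ₀) (h2 : σ ≠ conjEmb X.τ₀) :
    ∃ lam : ℝ, 0 < lam ∧ ∀ v : Fin 3 → ℂ, lam * ∑ i, ‖v i‖ ^ 2 ≤ |(star v ⬝ᵥ (X.H.map σ *ᵥ v)).re| :=
  exists_coercive_abs_of_isDefinite (X.hDef σ h1 h2)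

/-- A coercivity constant for every embedding (`1` at `τ₀`, `τ̄₀`, where nothing is needed). -/
def lamAll (σ : X.E →+* ℂ) : ℝ :=
  if h : σ ≠ X.τ₀ ∧ σ ≠ conjEmb X.τ₀ then Classical.choose (X.exists_lam σ h.1 h.2) else 1

/-- The coercivity constants are positive. -/
theorem lamAll_pos (σ : X.E →+* ℂ) : 0 < X.lamAll σ := by
  unfold lamAll
  split_ifs with h
  · exact (Classical.choose_spec (X.exists_lam σ h.1 h.2)).1
  · exact one_pos

/-- The coercivity bound at a definite embedding. -/
theorem lamAll_spec (σ : X.E →+* ℂ) (h1 : σ ≠ X.τ₀) (h2 : σ ≠ conjEmb X.τ₀) (v : Fin 3 → ℂ) :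
    X.lamAll σ * ∑ i, ‖v i‖ ^ 2 ≤ |(star v ⬝ᵥ (X.H.map σ *ᵥ v)).re| := by
  unfold lamAll
  rw [dif_pos ⟨h1, h2⟩]
  exact (Classical.choose_spec (X.exists_lam σ h1 h2)).2 v

/-- The uniform decay constant `c₀ = π · min_σ λ_σ`. -/
def c₀W : ℝ := Real.pi * Finset.univ.inf' Finset.univ_nonempty X.lamAll

/-- `0 < c₀`. -/
theorem c₀W_pos : 0 < X.c₀W :=
  mul_pos Real.pi_pos ((Finset.lt_inf'_iff _).mpr fun σ _ => X.lamAll_pos σ)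

/-- `c₀ ≤ π λ_σ` for every `σ`. -/
theorem c₀W_le (σ : X.E →+* ℂ) : X.c₀W ≤ Real.pi * X.lamAll σ :=
  mul_le_mul_of_nonneg_left (Finset.inf'_le _ (Finset.mem_univ σ)) Real.pi_pos.le

/-- The Gaussian of the definite places is at most any one of its factors. -/
theorem gaussDef_le (σ : X.E →+* ℂ) (h1 : σ ≠ X.τ₀) (h2 : σ ≠ conjEmb X.τ₀) (x : Fin 3 → X.E) :
    X.gaussDef x ≤
      Real.exp (-(Real.pi * |(star (fun i => σ (x i)) ⬝ᵥ ((X.H.map σ) *ᵥ (fun i => σ (x i)))).re|)) := by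
  unfold gaussDef
  set F : (X.E →+* ℂ) → ℝ := fun σ' =>
    Real.exp (-(Real.pi * |(star (fun i => σ' (x i)) ⬝ᵥ ((X.H.map σ') *ᵥ (fun i => σ' (x i)))).re|)) with hF
  have hF1 : ∀ σ', F σ' ≤ 1 := fun σ' => by
    rw [hF]
    simp only
    rw [Real.exp_le_one_iff, neg_nonpos]
    exact mul_nonneg Real.pi_pos.le (abs_nonneg _)
  have hF0 : ∀ σ', 0 ≤ F σ' := fun σ' => (Real.exp_pos _).le
  rw [finprod_cond_eq_prod_of_cond_iff F (t := Finset.univ.filter fun σ' => σ' ≠ X.τ₀ ∧ σ' ≠ conjEmb X.τ₀)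
    (fun _ => by simp)]
  have hσ : σ ∈ Finset.univ.filter fun σ' => σ' ≠ X.τ₀ ∧ σ' ≠ conjEmb X.τ₀ := by simp [h1, h2]
  rw [← Finset.mul_prod_erase _ F hσ]
  calc F σ * ∏ σ' ∈ (Finset.univ.filter fun σ' => σ' ≠ X.τ₀ ∧ σ' ≠ conjEmb X.τ₀).erase σ, F σ'
      ≤ F σ * 1 := by
        gcongr
        exact Finset.prod_le_one (fun σ' _ => hF0 σ') (fun σ' _ => hF1 σ')
    _ = F σ := mul_one _

/-- `decay`: the witness decays like a Gaussian in the coordinates of every definite embedding. -/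
theorem cfW_decay : ∃ C e c₀ : ℝ, 0 < c₀ ∧ ∀ j x, ∀ σ : X.E →+* ℂ, σ ≠ X.τ₀ → σ ≠ conjEmb X.τ₀ →
    ‖X.cfW j x‖ ≤ C * (1 + ‖X.ballCoord x‖) ^ e * Real.exp (-(c₀ * ∑ i, ‖σ (x i)‖ ^ 2)) := by
  refine ⟨1, 0, X.c₀W, X.c₀W_pos, fun j x σ h1 h2 => ?_⟩
  rw [Real.rpow_zero, one_mul, one_mul]
  have hcf : ‖X.cfW j x‖ ≤ X.gaussDef x := by
    unfold cfW
    split_ifs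
    · rw [Complex.norm_real, Real.norm_eq_abs, abs_of_pos (X.gaussDef_pos x)]
    · rw [norm_zero]
      exact (X.gaussDef_pos x).le
  refine hcf.trans ((X.gaussDef_le σ h1 h2 x).trans ?_)
  rw [Real.exp_le_exp, neg_le_neg_iff]
  calc X.c₀W * ∑ i, ‖σ (x i)‖ ^ 2 ≤ Real.pi * X.lamAll σ * ∑ i, ‖σ (x i)‖ ^ 2 := by
        gcongr
        exact X.c₀W_le σ
    _ = Real.pi * (X.lamAll σ * ∑ i, ‖σ (x i)‖ ^ 2) := by ring
    _ ≤ Real.pi * |(star (fun i => σ (x i)) ⬝ᵥ ((X.H.map σ) *ᵥ (fun i => σ (x i)))).re| := by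
        gcongr
        exact X.lamAll_spec σ h1 h2 _

end T4Data

end

end Summit.Ventures.HodgeRepro.Tier4.Line3
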